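import Mathlib.MeasureTheory.Measure.Haar.Unique
import Mathlib.Topology.Algebra.OpenSubgroup
import Mathlib.Topology.Sets.Compacts
import HarnessLib

/-!
# Normalised Haar measure relative to an integral structure

Classical measure theory underlying the "volumes" of [AbsTopIII] Proposition 5.7 (i) and
[IUTchIV] Proposition 1.4 (i), stated once for an ARBITRARY locally compact abelian group `V`
carrying an *integral structure* `Λ` — a compact open additive subgroup (the "`O_k ⊆ k`" of a
nonarchimedean local field, the "`(R_E)^∼ ⊆ ⊗ k_i`" of a tensor packet, the "`∏ O_{K_w}`" of a
direct sum of local fields, a `ℤ_p`-lattice in a finite-dimensional `ℚ_p`-vector space, …), so that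
every container used downstream instantiates it:

* `IntegralStructure V` — the data `Λ`; `Λ.haar` — THE additive Haar measure with `Λ.haar Λ = 1`
  ([AbsTopIII] Prop. 5.7 (i)(a): "There exists a unique map `μ_k : M(k) → ℝ_{>0}` that satisfies …
  (1) additivity … (2) ⊞-translation invariance … (3) normalization, i.e., `μ_k(O_k) = 1`"), with its
  uniqueness among regular Haar measures (`haar_unique`, `eq_haar`);
* the index formula `Λ.haar H = [Λ : H]⁻¹` for an open subgroup `H ≤ Λ` (`haar_coe_eq_inv_relIndex`)
  — whence all "lattice" volumes are index computations (e.g. "`μ^log_k(m_k^n) = −f·n·log p`");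
* the scaling rule under a continuous additive automorphism `φ` ([AbsTopIII] Prop. 5.7 (i)(b): "Let
  `x ∈ k^×`; set `μ̇_k(x) := μ_k(x·O_k)` … Then … `μ^log_k(x·A) = μ^log_k(A) + μ̇^log_k(x)`", here
  `Λ.haar (φ '' A) = Λ.haar (φ '' Λ) * Λ.haar A`, and `Λ.haar (φ '' Λ) = [Λ : φ(Λ)]⁻¹` when `φ(Λ) ⊆ Λ`);
* change of integral structure (`haar_eq_smul_haar`), the image structure `Λ.image φ`, and
  positivity/finiteness on the compact open sets `M(V)` of the source.

The (normalised) LOG-volumes `log μ_Λ(A)` and `log μ_Λ(A) / d` ([AbsTopIII] 5.7 (i)(a) "log-volume",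
[IUTchIV] 1.4 (i) "dividing by the degree") are in `LogVolume.lean`; the local-field statements AS
PRINTED are in `LocalFieldVolume.lean` / `ProductVolume.lean` of this directory. Design: `Λ.haar` is
Mathlib's `addHaarMeasure` on the positive compact `Λ`; nothing here mentions `p`, fields or norms.
[cite: MochizukiAbsTopIII2015, Prop. 5.7 (i) pp. 137–138] [cite: Mochizuki2012, IUTchIV Prop. 1.4 (i) p. 13]
Deliberately NOT here: any IUT-specific object, any judgement on [IUTchIII] Cor. 3.12.
-/

noncomputable section

open MeasureTheory MeasureTheory.Measure Set TopologicalSpace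
open scoped ENNReal NNReal Pointwise

namespace Literature.IUT.LogVolume

variable {V : Type*} [AddCommGroup V] [TopologicalSpace V]

/-- An **integral structure** on a topological abelian group `V`: a compact open additive subgroup
`Λ ⊆ V` (e.g. `O_k ⊆ k` for a nonarchimedean local field `k`, [AbsTopIII] Prop. 5.7 (i); the
"integral structures" `O ⊆ I^ℚ(−)` of [IUTchIII] Prop. 3.1 (ii) / Prop. 3.9 (i)).
[cite: MochizukiAbsTopIII2015, Prop. 5.7 (i) p. 137] -/
structure IntegralStructure (V : Type*) [AddCommGroup V] [TopologicalSpace V] where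
  /-- the underlying open additive subgroup -/
  toOpenAddSubgroup : OpenAddSubgroup V
  /-- … which is compact -/
  isCompact' : IsCompact (toOpenAddSubgroup : Set V)

namespace IntegralStructure

variable (Λ : IntegralStructure V)

/-- The integral structure as a subset of `V`. [cite: MochizukiAbsTopIII2015, Prop. 5.7 (i) p. 137] -/
instance : CoeTC (IntegralStructure V) (Set V) := ⟨fun Λ => (Λ.toOpenAddSubgroup : Set V)⟩

/-- Unfolding the coercion. [cite: MochizukiAbsTopIII2015, Prop. 5.7 (i) p. 137] -/
theorem coe_eq : (Λ : Set V) = (Λ.toOpenAddSubgroup : Set V) := rfl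

/-- `Λ` is compact. [cite: MochizukiAbsTopIII2015, Prop. 5.7 (i) p. 137] -/
theorem isCompact : IsCompact (Λ : Set V) := Λ.isCompact'

/-- `Λ` is open. [cite: MochizukiAbsTopIII2015, Prop. 5.7 (i) p. 137] -/
theorem isOpen : IsOpen (Λ : Set V) := Λ.toOpenAddSubgroup.isOpen

/-- `0 ∈ Λ`. [cite: MochizukiAbsTopIII2015, Prop. 5.7 (i) p. 137] -/
theorem zero_mem : (0 : V) ∈ (Λ : Set V) := Λ.toOpenAddSubgroup.toAddSubgroup.zero_mem

/-- `Λ` is nonempty. [cite: MochizukiAbsTopIII2015, Prop. 5.7 (i) p. 137] -/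
theorem nonempty : (Λ : Set V).Nonempty := ⟨0, Λ.zero_mem⟩

/-- `Λ` as a positive compact (compact with nonempty interior — it is open).
[cite: MochizukiAbsTopIII2015, Prop. 5.7 (i) p. 137] -/
def positiveCompacts : PositiveCompacts V :=
  ⟨⟨(Λ : Set V), Λ.isCompact⟩, by
    change (interior (Λ : Set V)).Nonempty
    rw [Λ.isOpen.interior_eq]
    exact Λ.nonempty⟩

/-- Unfolding `positiveCompacts`. [cite: MochizukiAbsTopIII2015, Prop. 5.7 (i) p. 137] -/
@[simp] theorem coe_positiveCompacts : (Λ.positiveCompacts : Set V) = (Λ : Set V) := rfl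

variable [IsTopologicalAddGroup V]

include Λ in
/-- A group with an integral structure is locally compact.
[cite: MochizukiAbsTopIII2015, Prop. 5.7 (i) p. 137] -/
theorem locallyCompactSpace : LocallyCompactSpace V :=
  TopologicalSpace.PositiveCompacts.locallyCompactSpace_of_addGroup Λ.positiveCompacts

/-- An open subgroup `H ≤ Λ` has finite index in `Λ` (open in a compact group).
[cite: MochizukiAbsTopIII2015, Prop. 5.7 (i)(a) p. 137] -/
theorem finiteIndex_addSubgroupOf (H : OpenAddSubgroup V) :
    ((H : AddSubgroup V).addSubgroupOf (Λ.toOpenAddSubgroup : AddSubgroup V)).FiniteIndex := by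
  let L : AddSubgroup V := Λ.toOpenAddSubgroup
  haveI : CompactSpace L := isCompact_iff_compactSpace.mp Λ.isCompact
  haveI := AddSubgroup.quotient_finite_of_isOpen ((H : AddSubgroup V).addSubgroupOf L)
    (AddSubgroup.addSubgroupOf_isOpen _ _ H.isOpen)
  exact AddSubgroup.finiteIndex_of_finite_quotient

/-- The relative index `[Λ : H ∩ Λ]` of an open subgroup is a positive natural number.
[cite: MochizukiAbsTopIII2015, Prop. 5.7 (i)(a) p. 137] -/
theorem relIndex_pos (H : OpenAddSubgroup V) :
    0 < (H : AddSubgroup V).relIndex (Λ.toOpenAddSubgroup : AddSubgroup V) := by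
  haveI := Λ.finiteIndex_addSubgroupOf H
  exact Nat.pos_of_ne_zero AddSubgroup.FiniteIndex.index_ne_zero

variable [MeasurableSpace V] [BorelSpace V]

omit [IsTopologicalAddGroup V] in
/-- `Λ` is measurable. [cite: MochizukiAbsTopIII2015, Prop. 5.7 (i) p. 137] -/
theorem measurableSet : MeasurableSet (Λ : Set V) := Λ.isOpen.measurableSet

/-- **The volume on `V` normalised by `Λ`**: the additive Haar measure `μ_Λ` with `μ_Λ(Λ) = 1`
("(1) additivity … (2) ⊞-translation invariance … (3) normalization, i.e., `μ_k(O_k) = 1`. We shall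
refer to `μ_k(−)` as the volume on `k`"). [cite: MochizukiAbsTopIII2015, Prop. 5.7 (i)(a) p. 137] -/
def haar : Measure V := addHaarMeasure Λ.positiveCompacts

/-- Normalisation: `μ_Λ(Λ) = 1`. [cite: MochizukiAbsTopIII2015, Prop. 5.7 (i)(a)(3) p. 137] -/
@[simp] theorem haar_self : Λ.haar (Λ : Set V) = 1 := by
  rw [haar, ← coe_positiveCompacts]
  exact addHaarMeasure_self

/-- `μ_Λ` is an additive Haar measure (translation invariant, finite on compacts, positive on opens).
[cite: MochizukiAbsTopIII2015, Prop. 5.7 (i)(a)(1)(2) p. 137] -/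
instance isAddHaarMeasure_haar : IsAddHaarMeasure Λ.haar := by
  unfold haar; infer_instance

/-- `μ_Λ` is regular. [cite: MochizukiAbsTopIII2015, Prop. 5.7 (i)(a) p. 137] -/
instance regular_haar : Λ.haar.Regular := by
  unfold haar; infer_instance

/-- Translation invariance: `μ_Λ(x + A) = μ_Λ(A)`.
[cite: MochizukiAbsTopIII2015, Prop. 5.7 (i)(a)(2) p. 137] -/
theorem haar_vadd (x : V) (A : Set V) : Λ.haar (x +ᵥ A) = Λ.haar A :=
  measure_vadd _ _ _

/-- Additivity on disjoint measurable sets: `μ_Λ(A ∪ B) = μ_Λ(A) + μ_Λ(B)`.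
[cite: MochizukiAbsTopIII2015, Prop. 5.7 (i)(a)(1) p. 137] -/
theorem haar_union {A B : Set V} (hB : MeasurableSet B) (h : Disjoint A B) :
    Λ.haar (A ∪ B) = Λ.haar A + Λ.haar B :=
  measure_union h hB

/-- Nonempty open sets have positive volume. [cite: MochizukiAbsTopIII2015, Prop. 5.7 (i)(a) p. 137] -/
theorem haar_pos_of_isOpen {A : Set V} (hA : IsOpen A) (hne : A.Nonempty) : 0 < Λ.haar A :=
  hA.measure_pos Λ.haar hne

/-- Compact sets have finite volume. [cite: MochizukiAbsTopIII2015, Prop. 5.7 (i)(a) p. 137] -/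
theorem haar_lt_top_of_isCompact {A : Set V} (hA : IsCompact A) : Λ.haar A < ∞ :=
  hA.measure_lt_top

/-- **Uniqueness** (Haar form of [AbsTopIII] Prop. 5.7 (i)(a)): every regular additive Haar measure
`μ` on `V` is `μ(Λ) · μ_Λ`. [cite: MochizukiAbsTopIII2015, Prop. 5.7 (i)(a) p. 137] -/
theorem haar_unique (μ : Measure V) [IsAddHaarMeasure μ] [μ.Regular] :
    μ = μ (Λ : Set V) • Λ.haar := by
  haveI : LocallyCompactSpace V := Λ.locallyCompactSpace
  have h := isAddLeftInvariant_eq_smul_of_regular μ Λ.haar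
  have hc : μ (Λ : Set V) = (addHaarScalarFactor μ Λ.haar : ℝ≥0∞) := by
    conv_lhs => rw [h]
    rw [Measure.coe_nnreal_smul_apply, haar_self, mul_one]
  rw [hc, Measure.coe_nnreal_smul]
  exact h

/-- **Uniqueness**: a regular additive Haar measure `μ` with `μ(Λ) = 1` IS `μ_Λ` ("there exists a
unique map … that satisfies … (1) additivity … (2) ⊞-translation invariance … (3) normalization").
[cite: MochizukiAbsTopIII2015, Prop. 5.7 (i)(a) p. 137] -/
theorem eq_haar (μ : Measure V) [IsAddHaarMeasure μ] [μ.Regular] (hμ : μ (Λ : Set V) = 1) :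
    μ = Λ.haar := by
  rw [Λ.haar_unique μ, hμ, one_smul]

/-! ### Index formula: volumes of open subgroups -/

omit [IsTopologicalAddGroup V] in
/-- The inclusion `Λ ↪ V` is a measurable embedding (Λ is open, hence measurable). [folklore] -/
private theorem measurableEmbedding_coe :
    MeasurableEmbedding ((↑) : Λ.toOpenAddSubgroup.toAddSubgroup → V) :=
  MeasurableEmbedding.subtype_coe Λ.measurableSet

/-- The restriction of `μ_Λ` to the compact open subgroup `Λ` is translation invariant on `Λ`.
[cite: MochizukiAbsTopIII2015, Prop. 5.7 (i)(a)(2) p. 137] -/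
theorem isAddLeftInvariant_comap :
    (Λ.haar.comap ((↑) : Λ.toOpenAddSubgroup.toAddSubgroup → V)).IsAddLeftInvariant := by
  have hemb := Λ.measurableEmbedding_coe
  refine ⟨fun g => ?_⟩
  ext A hA
  rw [map_apply (measurable_const_add g) hA, hemb.comap_apply, hemb.comap_apply]
  have hset : ((↑) : Λ.toOpenAddSubgroup.toAddSubgroup → V) '' ((fun x => g + x) ⁻¹' A) =
      (fun x : V => (g : V) + x) ⁻¹'
        (((↑) : Λ.toOpenAddSubgroup.toAddSubgroup → V) '' A) := by
    ext x
    constructor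
    · rintro ⟨a, ha, rfl⟩
      exact ⟨g + a, ha, by simp⟩
    · rintro ⟨a, ha, hax⟩
      simp only at hax
      have hx : x ∈ (Λ.toOpenAddSubgroup : AddSubgroup V) := by
        have : x = (a : V) - (g : V) := by rw [hax]; abel
        rw [this]
        exact sub_mem a.2 g.2
      refine ⟨⟨x, hx⟩, ?_, rfl⟩
      change g + ⟨x, hx⟩ ∈ A
      have : g + ⟨x, hx⟩ = a := by
        ext
        change (g : V) + x = a
        rw [hax]
      rwa [this]
  rw [hset, measure_preimage_add]

/-- **Coset counting**: for an open subgroup `H ≤ Λ`, `[Λ : H] · μ_Λ(H) = 1`.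
[cite: MochizukiAbsTopIII2015, Prop. 5.7 (i)(a) p. 137] -/
theorem relIndex_mul_haar_coe (H : OpenAddSubgroup V)
    (hH : (H : AddSubgroup V) ≤ (Λ.toOpenAddSubgroup : AddSubgroup V)) :
    ((H : AddSubgroup V).relIndex (Λ.toOpenAddSubgroup : AddSubgroup V) : ℝ≥0∞) *
      Λ.haar (H : Set V) = 1 := by
  haveI := Λ.finiteIndex_addSubgroupOf H
  haveI := Λ.isAddLeftInvariant_comap
  have hemb := Λ.measurableEmbedding_coe
  set H' := (H : AddSubgroup V).addSubgroupOf (Λ.toOpenAddSubgroup : AddSubgroup V) with hH'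
  have hHm : MeasurableSet (H' : Set (Λ.toOpenAddSubgroup : AddSubgroup V)) := by
    rw [hH', AddSubgroup.coe_addSubgroupOf]
    exact measurable_subtype_coe H.isOpen.measurableSet
  have key := AddSubgroup.index_mul_measure H' hHm
    (Λ.haar.comap ((↑) : Λ.toOpenAddSubgroup.toAddSubgroup → V))
  rw [hemb.comap_apply, hemb.comap_apply, image_univ, Subtype.range_coe_subtype] at key
  have h1 : ((↑) : Λ.toOpenAddSubgroup.toAddSubgroup → V) ''
      (H' : Set (Λ.toOpenAddSubgroup : AddSubgroup V)) = (H : Set V) := by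
    rw [hH', AddSubgroup.coe_addSubgroupOf, AddSubgroup.coe_subtype]
    ext x
    constructor
    · rintro ⟨a, ha, rfl⟩
      exact ha
    · intro hx
      exact ⟨⟨x, hH hx⟩, hx, rfl⟩
  have h2 : {x : V | x ∈ (Λ.toOpenAddSubgroup : AddSubgroup V)} = (Λ : Set V) := rfl
  rw [h1, h2, haar_self] at key
  exact key

/-- **Index formula**: `μ_Λ(H) = [Λ : H]⁻¹` for an open subgroup `H ≤ Λ` (e.g. `μ_k(m_k^n) = q^{−n}`).
[cite: MochizukiAbsTopIII2015, Prop. 5.7 (i)(a) p. 137] -/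
theorem haar_coe_eq_inv_relIndex (H : OpenAddSubgroup V)
    (hH : (H : AddSubgroup V) ≤ (Λ.toOpenAddSubgroup : AddSubgroup V)) :
    Λ.haar (H : Set V) =
      (((H : AddSubgroup V).relIndex (Λ.toOpenAddSubgroup : AddSubgroup V) : ℝ≥0∞))⁻¹ := by
  have key := Λ.relIndex_mul_haar_coe H hH
  have hq : ((H : AddSubgroup V).relIndex (Λ.toOpenAddSubgroup : AddSubgroup V) : ℝ≥0∞) ≠ 0 := by
    exact_mod_cast (Λ.relIndex_pos H).ne'
  have hq' : ((H : AddSubgroup V).relIndex (Λ.toOpenAddSubgroup : AddSubgroup V) : ℝ≥0∞) ≠ ∞ :=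
    ENNReal.natCast_ne_top _
  rw [← mul_one ((_ : ℝ≥0∞))⁻¹, ← key, ← mul_assoc, ENNReal.inv_mul_cancel hq hq', one_mul]

/-! ### Scaling under continuous additive automorphisms ([AbsTopIII] Prop. 5.7 (i)(b)) -/

/-- The image of `Λ` under a continuous additive automorphism has positive finite volume.
[cite: MochizukiAbsTopIII2015, Prop. 5.7 (i)(b) p. 138] -/
theorem haar_image_self_pos (φ : V ≃ₜ+ V) : 0 < Λ.haar (φ '' (Λ : Set V)) :=
  Λ.haar_pos_of_isOpen (φ.toHomeomorph.isOpenMap _ Λ.isOpen) (Λ.nonempty.image _)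

/-- … and finite volume. [cite: MochizukiAbsTopIII2015, Prop. 5.7 (i)(b) p. 138] -/
theorem haar_image_self_lt_top (φ : V ≃ₜ+ V) : Λ.haar (φ '' (Λ : Set V)) < ∞ :=
  Λ.haar_lt_top_of_isCompact (Λ.isCompact.image φ.continuous)

/-- **Volume scaling**: a continuous additive automorphism `φ` of `V` multiplies `μ_Λ` by the constant
`μ_Λ(φ(Λ))`: `μ_Λ(φ(A)) = μ_Λ(φ(Λ)) · μ_Λ(A)` — the modulus of `φ`; for `φ = (x · −)` on a local
field this is "`μ̇_k(x) := μ_k(x·O_k)`". [cite: MochizukiAbsTopIII2015, Prop. 5.7 (i)(b) p. 138] -/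
theorem haar_image (φ : V ≃ₜ+ V) (A : Set V) :
    Λ.haar (φ '' A) = Λ.haar (φ '' (Λ : Set V)) * Λ.haar A := by
  haveI : LocallyCompactSpace V := Λ.locallyCompactSpace
  -- the pulled-back measure `A ↦ μ_Λ(φ(A))` is `map φ⁻¹ μ_Λ`, a regular Haar measure
  let ν : Measure V := Λ.haar.map φ.symm
  haveI : IsAddHaarMeasure ν := φ.symm.isAddHaarMeasure_map Λ.haar
  haveI : ν.Regular := Regular.map φ.symm.toHomeomorph
  have hν : ∀ B : Set V, ν B = Λ.haar (φ '' B) := fun B => by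
    change (Λ.haar.map φ.symm.toHomeomorph.toMeasurableEquiv) B = _
    rw [MeasurableEquiv.map_apply]
    congr 1
    exact (φ.toEquiv.image_eq_preimage_symm B).symm
  have hu := Λ.haar_unique ν
  have := congrArg (fun m : Measure V => m A) hu
  simp only [Measure.smul_apply, smul_eq_mul] at this
  rw [hν, hν] at this
  exact this

/-- Automorphisms preserving the integral structure preserve volumes ("in particular, if `x ∈ O_k^×`,
then `μ^log_k(x·A) = μ^log_k(A)`"). [cite: MochizukiAbsTopIII2015, Prop. 5.7 (i)(b) p. 138] -/
theorem haar_image_of_image_eq (φ : V ≃ₜ+ V) (hφ : φ '' (Λ : Set V) = (Λ : Set V)) (A : Set V) :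
    Λ.haar (φ '' A) = Λ.haar A := by
  rw [Λ.haar_image φ A, hφ, haar_self, one_mul]

/-! ### Change of integral structure -/

/-- Two integral structures on the same group give proportional volumes:
`μ_{Λ'} = μ_Λ(Λ')⁻¹ · μ_Λ`. [cite: MochizukiAbsTopIII2015, Prop. 5.7 (i)(a) p. 137] -/
theorem haar_eq_smul_haar (Λ' : IntegralStructure V) :
    Λ'.haar = (Λ.haar (Λ' : Set V))⁻¹ • Λ.haar := by
  have h := Λ'.haar_unique Λ.haar
  have h0 : Λ.haar (Λ' : Set V) ≠ 0 := (Λ.haar_pos_of_isOpen Λ'.isOpen Λ'.nonempty).ne'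
  have ht : Λ.haar (Λ' : Set V) ≠ ∞ := (Λ.haar_lt_top_of_isCompact Λ'.isCompact).ne
  have : (Λ.haar (Λ' : Set V))⁻¹ • Λ.haar = (Λ.haar (Λ' : Set V))⁻¹ • (Λ.haar (Λ' : Set V) • Λ'.haar) :=
    congrArg _ h
  rw [this, smul_smul, ENNReal.inv_mul_cancel h0 ht, one_smul]

/-! ### Images of the integral structure under automorphisms; compact open regions -/

/-- The image `φ(Λ)` of the integral structure under a continuous additive automorphism `φ`, as an
open subgroup (the preimage of `Λ` under `φ⁻¹`). [cite: MochizukiAbsTopIII2015, Prop. 5.7 (i)(b) p. 138] -/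
def imageOpenAddSubgroup (φ : V ≃ₜ+ V) : OpenAddSubgroup V :=
  Λ.toOpenAddSubgroup.comap (φ.symm.toAddEquiv : V →+ V) φ.symm.continuous

omit [IsTopologicalAddGroup V] [MeasurableSpace V] [BorelSpace V] in
/-- `φ(Λ)` as a set. [cite: MochizukiAbsTopIII2015, Prop. 5.7 (i)(b) p. 138] -/
@[simp] theorem coe_imageOpenAddSubgroup (φ : V ≃ₜ+ V) :
    (Λ.imageOpenAddSubgroup φ : Set V) = φ '' (Λ : Set V) := by
  rw [imageOpenAddSubgroup, OpenAddSubgroup.coe_comap, coe_eq]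
  ext x
  simp only [mem_preimage, AddMonoidHom.coe_coe, SetLike.mem_coe, mem_image]
  constructor
  · intro hx
    exact ⟨φ.symm x, hx, by simp⟩
  · rintro ⟨y, hy, rfl⟩
    have : φ.symm.toAddEquiv (φ y) = y := φ.symm_apply_apply y
    rw [this]
    exact hy

/-- The image `φ(Λ)` is again an integral structure (compact open subgroup).
[cite: MochizukiAbsTopIII2015, Prop. 5.7 (i)(b) p. 138] -/
def image (φ : V ≃ₜ+ V) : IntegralStructure V :=
  ⟨Λ.imageOpenAddSubgroup φ, by
    rw [coe_imageOpenAddSubgroup]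
    exact Λ.isCompact.image φ.continuous⟩

omit [IsTopologicalAddGroup V] [MeasurableSpace V] [BorelSpace V] in
/-- `Λ.image φ` as a set is `φ(Λ)`. [cite: MochizukiAbsTopIII2015, Prop. 5.7 (i)(b) p. 138] -/
@[simp] theorem coe_image (φ : V ≃ₜ+ V) : (Λ.image φ : Set V) = φ '' (Λ : Set V) :=
  Λ.coe_imageOpenAddSubgroup φ

/-- **Modulus as an index**: if `φ(Λ) ⊆ Λ` then `μ_Λ(φ(Λ)) = [Λ : φ(Λ)]⁻¹` (e.g. `μ_k(ϖ^n O_k) =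
q^{−n}`, `μ(p·R) = p^{−[k:ℚ_p]}`). [cite: MochizukiAbsTopIII2015, Prop. 5.7 (i)(a)(b) pp. 137–138] -/
theorem haar_image_self_eq_inv_relIndex (φ : V ≃ₜ+ V) (hφ : MapsTo φ (Λ : Set V) (Λ : Set V)) :
    Λ.haar (φ '' (Λ : Set V)) =
      (((Λ.imageOpenAddSubgroup φ : AddSubgroup V).relIndex
        (Λ.toOpenAddSubgroup : AddSubgroup V) : ℝ≥0∞))⁻¹ := by
  rw [← coe_imageOpenAddSubgroup]
  refine Λ.haar_coe_eq_inv_relIndex (Λ.imageOpenAddSubgroup φ) ?_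
  intro x hx
  have hx' : x ∈ (Λ.imageOpenAddSubgroup φ : Set V) := hx
  rw [coe_imageOpenAddSubgroup] at hx'
  exact hφ.image_subset hx'

/-- The set `M(V)` of the sources: compact open subsets have finite volume …
[cite: MochizukiAbsTopIII2015, Prop. 5.7 (i)(a) p. 137] -/
theorem haar_compactOpens_lt_top (A : CompactOpens V) : Λ.haar (A : Set V) < ∞ :=
  Λ.haar_lt_top_of_isCompact A.isCompact

/-- … and, when nonempty, positive volume ("`μ_k : M(k) → ℝ_{>0}`").
[cite: MochizukiAbsTopIII2015, Prop. 5.7 (i)(a) p. 137] -/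
theorem haar_compactOpens_pos (A : CompactOpens V) (hne : (A : Set V).Nonempty) :
    0 < Λ.haar (A : Set V) :=
  Λ.haar_pos_of_isOpen A.isOpen hne

/-- The real-valued volume `μ_Λ(A) ∈ ℝ_{>0}` of a nonempty compact open set.
[cite: MochizukiAbsTopIII2015, Prop. 5.7 (i)(a) p. 137] -/
theorem haar_real_compactOpens_pos (A : CompactOpens V) (hne : (A : Set V).Nonempty) :
    0 < (Λ.haar (A : Set V)).toReal :=
  ENNReal.toReal_pos (Λ.haar_compactOpens_pos A hne).ne' (Λ.haar_compactOpens_lt_top A).ne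

end IntegralStructure

end Literature.IUT.LogVolume
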